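import Summits.AtomisticToContinuum.HydrodynamicLimit.Theorems.AntiMazurCoboundariesCorrectorPressureDecayKiferFreeCountVarianceCore
import Summits.AtomisticToContinuum.HydrodynamicLimit.Theorems.AntiMazurCoboundariesCorrectorPressureDecayKiferCanonicalLocalLimitTranslation

/-!
# The particle number of a free low-activity hard-sphere box has variance `O(volume)` (line `FirstLemma`, crux stmt-AtomisticToContinuum-14135)

Registered stub `c9_free_count_variance_le` (lead seat c9; piece (B2) of the thermodynamic step of the Gibbs route of
`stub_tangentEntropyBoundUniformGibbs`: typicality of the canonical particle number under the free cell measure via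
Chebyshev), namespace `Summit.AtomisticToContinuum.HydrodynamicLimit.Theorems.KiferCompactification`.  No definitions
(file-local notations as in the core file `…KiferFreeCountVarianceCore.lean`, plus `c9vℒ n = {0,…,2n+1}³`).

For the free grand-canonical unit-diameter hard-sphere measure `R_n = γ_{Λ_n}(· | ∅) = gibbsSpecMeasure 1 z β u Λ_n ∅`
on `Λ_n = centredBox n = [-(n+1), n+1)³`, activity `0 < z ≤ 1/64`, `β > 0`:

  `Var_{R_n}(N) = ∫ (N - ∫ N dR_n)² dR_n ≤ C · (n+1)³`,  `C` independent of `n`  (`c9_free_count_variance_le`).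

Proof. `Λ_n` is tiled by the `8(n+1)³` unit cubes `k - (n+1)𝟙 + [0,1)³`, `k ∈ {0,…,2n+1}³` (`c9v_centredBox_eq_biUnion`;
`Λ_n` is measurable and bounded, `…KiferCanonicalLocalLimitTranslation`);
`R_n`-a.s. the configuration is unit-hard-core and has no particle off `Λ_n × ℝ³`, so by packing (`N_cube ≤ 8`, core
file) `N = ∑_k ∑_{i<8} 1{i < N_k}` a.s., a finite sum of indicators, whose variance is the double sum of the covariances
`R_n(A ∩ E) - R_n(A) R_n(E)` (`c9v_integral_sq_sum_indicator_sub`).  Each covariance is at most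
`(3/2)^13 (2/3)^{‖k-k'‖₁}` (core file, `c9_free_cube_count_cov_le`: decorrelation of the free measure transported from balls to
boxes), and `∑_{k'} (2/3)^{‖k-k'‖₁} ≤ (sup_m ∑_j (2/3)^{|m-j|})³ ≤ 6³` uniformly in `k` and `n`
(`c9v_sum_range_two_thirds_pow_le`), whence `Var N ≤ 64 · 8(n+1)³ · (3/2)^13 · 6³`.

References: D. Ruelle, *Statistical Mechanics: Rigorous Results* (1969), §4.2 (cluster bounds of the low-activity gas);
M. Michelen, W. Perkins, arXiv:2109.01094, Thm 25 (decorrelation at low activity).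
-/

noncomputable section

open MeasureTheory ProbabilityTheory Set Filter Topology
open scoped ENNReal NNReal

namespace Summit.AtomisticToContinuum.HydrodynamicLimit.Theorems.KiferCompactification

open Literature.MathematicalPhysics.KineticTheory (V3 hsLocalSpec hsLocalSpec_def hsLocalSpec_shift glue_empty
  ae_restrict_eq_self isProbabilityMeasure_hsLocalSpec hsLocalSpec_ae_isHardCore hsLocalSpec_empty_ae_restrict_eq_self
  preimage_window shift_eq_translate abs_measureReal_inter_sub_mul_le window_mono measurableSet_preimage_add
  isBounded_preimage_add)
open Literature.MathematicalPhysics.KineticTheory.HardSphereDLR (gibbsSpecMeasure gibbsSpecMeasure_apply)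
open Literature.MathematicalPhysics.KineticTheory.PointProcess (centredBox)
open Literature.Analysis.FunctionSpaces (PointConfig maxwellianBeta IsPoissonPointProcess)
open Literature.MathematicalPhysics.StatisticalMechanics (hsLocalSpec_eq_gibbsSpec smul_prod_uniqueness_hypotheses
  smul_prod_map_add isProbabilityMeasure_withDensity_maxwellianBeta)
open Literature.MathematicalPhysics.StatisticalMechanics.HardSphere (Pos Phase window hardCoreSet glue poissonLaw shift
  IsHardCore isHardCore_empty measurableSet_window mem_window shift_empty measurable_shift)

/-- File-local notation: the unit cube `k + t𝟙 + [0,1)³` of the lattice `ℕ³ + t𝟙` (`t ∈ ℝ`). -/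
local notation3 (prettyPrint := false) "c9v𝒬 " k:max t:max =>
  ({x : V3 | ∀ i, x i ∈ Set.Ico ((k i : ℝ) + t) ((k i : ℝ) + t + 1)} : Set V3)

/-- File-local notation: the one-particle intensity `z · Leb ⊗ M_β(v-u)dv` of the grand-canonical hard-sphere gas. -/
local notation3 (prettyPrint := false) "c9vν " z:max β:max u:max =>
  (((Real.toNNReal z) • ((volume : Measure Pos).prod
    ((volume : Measure Pos).withDensity fun v => ENNReal.ofReal (maxwellianBeta β (v - u))))) : Measure Phase)

/-- File-local notation: the labels `{0,…,2n+1}³` of the unit cubes `k - (n+1)𝟙 + [0,1)³` tiling `Λ_n`. -/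
local notation3 (prettyPrint := false) "c9vℒ " n:max => (Fintype.piFinset fun _ : Fin 3 => Finset.range (2 * (n + 1)))

/-! ## Covariances of indicator sums -/

/-- The product of two centred indicators is integrable (bounded and measurable) under a finite measure. -/
theorem c9v_integrable_indicator_sub_mul {Ω : Type*} [MeasurableSpace Ω] (P : Measure Ω) [IsFiniteMeasure P]
    {A B : Set Ω} (hA : MeasurableSet A) (hB : MeasurableSet B) (p q : ℝ) :
    Integrable (fun ω => (A.indicator (1 : Ω → ℝ) ω - p) * (B.indicator (1 : Ω → ℝ) ω - q)) P := by
  refine Integrable.of_bound ?_ ((1 + |p|) * (1 + |q|)) (ae_of_all _ fun ω => ?_)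
  · exact (((measurable_one.indicator hA).sub measurable_const).mul
      ((measurable_one.indicator hB).sub measurable_const)).aestronglyMeasurable
  · have h1 : ∀ (S : Set Ω) (r : ℝ), |S.indicator (1 : Ω → ℝ) ω - r| ≤ 1 + |r| := fun S r => by
      have hS : |S.indicator (1 : Ω → ℝ) ω| ≤ 1 := by
        by_cases h : ω ∈ S
        · rw [indicator_of_mem h, Pi.one_apply, abs_one]
        · rw [indicator_of_notMem h, abs_zero]; exact zero_le_one
      exact (abs_sub _ _).trans (by linarith)
    rw [Real.norm_eq_abs, abs_mul]
    exact mul_le_mul (h1 A p) (h1 B q) (abs_nonneg _) (by positivity)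

/-- `∫ (1_A - p)(1_B - q) dP = P(A ∩ B) - q P(A) - p P(B) + p q` for a probability measure `P`. -/
theorem c9v_integral_indicator_sub_mul {Ω : Type*} [MeasurableSpace Ω] (P : Measure Ω)
    [IsProbabilityMeasure P] {A B : Set Ω} (hA : MeasurableSet A) (hB : MeasurableSet B) (p q : ℝ) :
    ∫ ω, (A.indicator (1 : Ω → ℝ) ω - p) * (B.indicator (1 : Ω → ℝ) ω - q) ∂P =
      P.real (A ∩ B) - q * P.real A - p * P.real B + p * q := by
  have hiA : Integrable (A.indicator (1 : Ω → ℝ)) P := (integrable_const 1).indicator hA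
  have hiB : Integrable (B.indicator (1 : Ω → ℝ)) P := (integrable_const 1).indicator hB
  have hiAB : Integrable ((A ∩ B).indicator (1 : Ω → ℝ)) P := (integrable_const 1).indicator (hA.inter hB)
  have h2 : Integrable (fun ω => (A ∩ B).indicator (1 : Ω → ℝ) ω - q * A.indicator (1 : Ω → ℝ) ω) P :=
    hiAB.sub (hiA.const_mul q)
  have h3 : Integrable (fun ω => (A ∩ B).indicator (1 : Ω → ℝ) ω - q * A.indicator (1 : Ω → ℝ) ω -
      p * B.indicator (1 : Ω → ℝ) ω) P := h2.sub (hiB.const_mul p)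
  have hexp : (fun ω => (A.indicator (1 : Ω → ℝ) ω - p) * (B.indicator (1 : Ω → ℝ) ω - q)) =
      fun ω => (A ∩ B).indicator (1 : Ω → ℝ) ω - q * A.indicator (1 : Ω → ℝ) ω - p * B.indicator (1 : Ω → ℝ) ω +
        p * q := by
    funext ω
    rw [inter_indicator_one, Pi.mul_apply]
    ring
  rw [hexp, integral_add h3 (integrable_const _), integral_sub h2 (hiB.const_mul p), integral_sub hiAB (hiA.const_mul q),
    integral_const_mul, integral_const_mul, integral_indicator_one (hA.inter hB), integral_indicator_one hA,
    integral_indicator_one hB, integral_const, probReal_univ, one_smul]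

/-- **Variance of a finite sum of indicators** under a probability measure:
`∫ (∑ₐ 1_{Aₐ} - ∑ₐ P(Aₐ))² dP = ∑ₐ ∑_b (P(Aₐ ∩ A_b) - P(Aₐ) P(A_b))`. -/
theorem c9v_integral_sq_sum_indicator_sub {Ω ι : Type*} [MeasurableSpace Ω] (P : Measure Ω)
    [IsProbabilityMeasure P] (s : Finset ι) {A : ι → Set Ω} (hA : ∀ a ∈ s, MeasurableSet (A a)) :
    ∫ ω, (∑ a ∈ s, (A a).indicator (1 : Ω → ℝ) ω - ∑ a ∈ s, P.real (A a)) ^ 2 ∂P =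
      ∑ a ∈ s, ∑ b ∈ s, (P.real (A a ∩ A b) - P.real (A a) * P.real (A b)) := by
  have hpt : ∀ ω, (∑ a ∈ s, (A a).indicator (1 : Ω → ℝ) ω - ∑ a ∈ s, P.real (A a)) ^ 2 =
      ∑ a ∈ s, ∑ b ∈ s, ((A a).indicator (1 : Ω → ℝ) ω - P.real (A a)) *
        ((A b).indicator (1 : Ω → ℝ) ω - P.real (A b)) := fun ω => by
    rw [← Finset.sum_sub_distrib, sq, Finset.sum_mul_sum]
  simp_rw [hpt]
  rw [integral_finsetSum _ fun a ha => integrable_finsetSum _ fun b hb =>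
    c9v_integrable_indicator_sub_mul P (hA a ha) (hA b hb) _ _]
  refine Finset.sum_congr rfl fun a ha => ?_
  rw [integral_finsetSum _ fun b hb => c9v_integrable_indicator_sub_mul P (hA a ha) (hA b hb) _ _]
  refine Finset.sum_congr rfl fun b hb => ?_
  rw [c9v_integral_indicator_sub_mul P (hA a ha) (hA b hb)]
  ring

/-- **Variance of a random variable that is a.s. a finite sum of indicators**: the double sum of the covariances
`P(Aₐ ∩ A_b) - P(Aₐ) P(A_b)`. -/
theorem c9v_variance_eq_sum_cov {Ω ι : Type*} [MeasurableSpace Ω] (P : Measure Ω) [IsProbabilityMeasure P]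
    (s : Finset ι) {A : ι → Set Ω} (hA : ∀ a ∈ s, MeasurableSet (A a)) {N : Ω → ℝ}
    (hN : ∀ᵐ ω ∂P, N ω = ∑ a ∈ s, (A a).indicator (1 : Ω → ℝ) ω) :
    ∫ ω, (N ω - ∫ ω', N ω' ∂P) ^ 2 ∂P = ∑ a ∈ s, ∑ b ∈ s, (P.real (A a ∩ A b) - P.real (A a) * P.real (A b)) := by
  have hAi : ∀ a ∈ s, Integrable ((A a).indicator (1 : Ω → ℝ)) P := fun a ha => (integrable_const (1 : ℝ)).indicator (hA a ha)
  have hmean : ∫ ω', N ω' ∂P = ∑ a ∈ s, P.real (A a) := by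
    rw [integral_congr_ae hN, integral_finsetSum _ hAi]
    exact Finset.sum_congr rfl fun a ha => integral_indicator_one (hA a ha)
  rw [hmean, ← c9v_integral_sq_sum_indicator_sub P s hA]
  refine integral_congr_ae ?_
  filter_upwards [hN] with ω hω
  rw [hω]

/-- A one-dimensional geometric lattice sum: `∑_{j < L} (2/3)^{|k - j|} ≤ 6`. -/
theorem c9v_sum_range_two_thirds_pow_le (L k : ℕ) :
    ∑ j ∈ Finset.range L, ((2 : ℝ) / 3) ^ ((k - j) + (j - k)) ≤ 6 := by
  have hq0 : (0 : ℝ) ≤ 2 / 3 := by norm_num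
  have hq1 : (2 : ℝ) / 3 < 1 := by norm_num
  have hgeom : ∀ s : Finset ℕ, ∑ i ∈ s, ((2 : ℝ) / 3) ^ i ≤ 3 := fun s =>
    calc ∑ i ∈ s, ((2 : ℝ) / 3) ^ i ≤ ∑' i, ((2 : ℝ) / 3) ^ i :=
          (summable_geometric_of_lt_one hq0 hq1).sum_le_tsum s fun i _ => by positivity
      _ = 3 := by rw [tsum_geometric_of_lt_one hq0 hq1]; norm_num
  have hsplit : ∀ j, ((2 : ℝ) / 3) ^ ((k - j) + (j - k)) ≤
      (if j ≤ k then ((2 : ℝ) / 3) ^ (k - j) else 0) + (if k < j then ((2 : ℝ) / 3) ^ (j - k) else 0) := by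
    intro j
    rcases le_or_gt j k with h | h
    · rw [if_pos h, if_neg (not_lt.2 h), Nat.sub_eq_zero_of_le h, add_zero, add_zero]
    · rw [if_neg (not_le.2 h), if_pos h, Nat.sub_eq_zero_of_le h.le, zero_add, zero_add]
  calc ∑ j ∈ Finset.range L, ((2 : ℝ) / 3) ^ ((k - j) + (j - k))
      ≤ ∑ j ∈ Finset.range L, ((if j ≤ k then ((2 : ℝ) / 3) ^ (k - j) else 0) +
          (if k < j then ((2 : ℝ) / 3) ^ (j - k) else 0)) := Finset.sum_le_sum fun j _ => hsplit j
    _ = ∑ j ∈ (Finset.range L).filter (· ≤ k), ((2 : ℝ) / 3) ^ (k - j) +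
          ∑ j ∈ (Finset.range L).filter (k < ·), ((2 : ℝ) / 3) ^ (j - k) := by
        rw [Finset.sum_add_distrib, Finset.sum_filter, Finset.sum_filter]
    _ ≤ 3 + 3 := by
        gcongr
        · rw [← Finset.sum_image (s := (Finset.range L).filter (· ≤ k)) (g := fun j => k - j)
            (f := fun i => ((2 : ℝ) / 3) ^ i) ?_]
          · exact hgeom _
          · intro x hx y hy hxy
            simp only [Finset.coe_filter, Finset.mem_range, mem_setOf_eq] at hx hy hxy
            omega
        · rw [← Finset.sum_image (s := (Finset.range L).filter (k < ·)) (g := fun j => j - k)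
            (f := fun i => ((2 : ℝ) / 3) ^ i) ?_]
          · exact hgeom _
          · intro x hx y hy hxy
            simp only [Finset.coe_filter, Finset.mem_range, mem_setOf_eq] at hx hy hxy
            omega
    _ = 6 := by norm_num

/-- `∑_{i < K} 1{i < m} = m` for `m ≤ K`. -/
theorem c9v_sum_range_ite_lt_eq {m K : ℕ} (h : m ≤ K) : ∑ i ∈ Finset.range K, (if i < m then (1 : ℝ) else 0) = m := by
  rw [Finset.sum_boole]
  have : (Finset.range K).filter (fun i => i < m) = Finset.range m := by
    ext i; simp only [Finset.mem_filter, Finset.mem_range]; omega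
  rw [this, Finset.card_range]

/-- **The lattice double sum is `O(#cubes)`**: for labels in `{0,…,L-1}³ × {0,…,7}` and terms bounded by
`(3/2)^13 (2/3)^{‖k-k'‖₁}`, `∑ₐ ∑_b f a b ≤ L³ · 64 · (3/2)^13 · 6³` (the sum over the partner label factorises into three
one-dimensional geometric sums `≤ 6`). -/
theorem c9v_sum_sum_le_of_le_geom (L : ℕ) {f : (Fin 3 → ℕ) × ℕ → (Fin 3 → ℕ) × ℕ → ℝ}
    (hf : ∀ a b, f a b ≤ (3 / 2) ^ 13 * (2 / 3) ^ (∑ l, ((a.1 l - b.1 l) + (b.1 l - a.1 l)))) :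
    ∑ a ∈ (Fintype.piFinset fun _ : Fin 3 => Finset.range L) ×ˢ Finset.range 8,
        ∑ b ∈ (Fintype.piFinset fun _ : Fin 3 => Finset.range L) ×ˢ Finset.range 8, f a b ≤
      (L : ℝ) ^ 3 * (64 * ((3 / 2) ^ 13 * 6 ^ 3)) := by
  set I : Finset (Fin 3 → ℕ) := Fintype.piFinset fun _ : Fin 3 => Finset.range L with hI
  have hgeom : ∀ k : Fin 3 → ℕ, ∑ k' ∈ I, ((2 : ℝ) / 3) ^ (∑ l, ((k l - k' l) + (k' l - k l))) ≤ 6 ^ 3 := fun k => by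
    have hprod : ∀ k' : Fin 3 → ℕ, ((2 : ℝ) / 3) ^ (∑ l, ((k l - k' l) + (k' l - k l))) =
        ∏ l, ((2 : ℝ) / 3) ^ ((k l - k' l) + (k' l - k l)) := fun k' => (Finset.prod_pow_eq_pow_sum _ _ _).symm
    simp_rw [hprod]
    rw [hI, Finset.sum_prod_piFinset (Finset.range L) (fun l j => ((2 : ℝ) / 3) ^ ((k l - j) + (j - k l)))]
    calc ∏ l, ∑ j ∈ Finset.range L, ((2 : ℝ) / 3) ^ ((k l - j) + (j - k l)) ≤ ∏ _l : Fin 3, (6 : ℝ) :=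
          Finset.prod_le_prod (fun l _ => Finset.sum_nonneg fun j _ => by positivity)
            fun l _ => c9v_sum_range_two_thirds_pow_le _ (k l)
      _ = 6 ^ 3 := by rw [Finset.prod_const, Finset.card_univ, Fintype.card_fin]
  have hcardI : (I.card : ℝ) = (L : ℝ) ^ 3 := by
    rw [hI, Fintype.card_piFinset, Finset.prod_const, Finset.card_range, Finset.card_univ, Fintype.card_fin]
    push_cast
    ring
  calc ∑ a ∈ I ×ˢ Finset.range 8, ∑ b ∈ I ×ˢ Finset.range 8, f a b
      ≤ ∑ a ∈ I ×ˢ Finset.range 8, ∑ b ∈ I ×ˢ Finset.range 8,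
          ((3 : ℝ) / 2) ^ 13 * (2 / 3) ^ (∑ l, ((a.1 l - b.1 l) + (b.1 l - a.1 l))) :=
        Finset.sum_le_sum fun a _ => Finset.sum_le_sum fun b _ => hf a b
    _ = ∑ k ∈ I, ∑ _i ∈ Finset.range 8, ∑ k' ∈ I, ∑ _j ∈ Finset.range 8,
          ((3 : ℝ) / 2) ^ 13 * (2 / 3) ^ (∑ l, ((k l - k' l) + (k' l - k l))) := by
        rw [Finset.sum_product]
        refine Finset.sum_congr rfl fun k _ => Finset.sum_congr rfl fun i _ => ?_
        rw [Finset.sum_product]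
    _ = ∑ k ∈ I, (8 * (8 * ((3 / 2 : ℝ) ^ 13 * ∑ k' ∈ I, ((2 : ℝ) / 3) ^ (∑ l, ((k l - k' l) + (k' l - k l)))))) := by
        refine Finset.sum_congr rfl fun k _ => ?_
        rw [Finset.sum_const, Finset.card_range, nsmul_eq_mul, Nat.cast_ofNat]
        congr 1
        rw [Finset.mul_sum, Finset.mul_sum]
        refine Finset.sum_congr rfl fun k' _ => ?_
        rw [Finset.sum_const, Finset.card_range, nsmul_eq_mul, Nat.cast_ofNat]
    _ ≤ ∑ _k ∈ I, (8 * (8 * ((3 / 2 : ℝ) ^ 13 * 6 ^ 3))) := Finset.sum_le_sum fun k _ => by gcongr; exact hgeom k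
    _ = (L : ℝ) ^ 3 * (64 * ((3 / 2) ^ 13 * 6 ^ 3)) := by rw [Finset.sum_const, nsmul_eq_mul, hcardI]; ring

/-! ## Disjoint cubes and counts of disjoint unions -/

/-- Cubes of the same lattice with distinct labels have disjoint windows. -/
theorem c9v_pairwiseDisjoint_window_cube (t : ℝ) (s : Set (Fin 3 → ℕ)) :
    s.PairwiseDisjoint fun k => window (c9v𝒬 k t) := by
  intro k _ k' _ hne
  change Disjoint (window (c9v𝒬 k t)) (window (c9v𝒬 k' t))
  refine disjoint_left.2 fun y hy hy' => hne (funext fun l => ?_)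
  rw [mem_window] at hy hy'
  have h := hy l
  have h' := hy' l
  rw [mem_Ico] at h h'
  have h1 : (k l : ℝ) < k' l + 1 := by linarith
  have h2 : (k' l : ℝ) < k l + 1 := by linarith
  have h1' : k l < k' l + 1 := by exact_mod_cast h1
  have h2' : k' l < k l + 1 := by exact_mod_cast h2
  omega

/-- The count of a finite disjoint union of regions is the sum of the counts. -/
theorem c9v_count_biUnion_eq_sum {ι : Type*} (s : Finset ι) {W : ι → Set Phase}
    (hW : (s : Set ι).PairwiseDisjoint W) (ω : PointConfig Phase) :
    ω.count (⋃ k ∈ s, W k) = ∑ k ∈ s, ω.count (W k) := by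
  classical
  induction s using Finset.induction_on with
  | empty => simp [PointConfig.count]
  | insert a s ha ih =>
    have hW' : (s : Set ι).PairwiseDisjoint W :=
      hW.subset fun k hk => Finset.mem_coe.2 (Finset.mem_insert_of_mem (Finset.mem_coe.1 hk))
    rw [Finset.set_biUnion_insert, Finset.sum_insert ha, ← ih hW']
    rw [PointConfig.count, PointConfig.count, PointConfig.count, inter_union_distrib_left, encard_union_eq]
    refine Disjoint.mono inter_subset_right inter_subset_right ?_
    rw [disjoint_iUnion₂_right]
    intro k hk
    exact hW (Finset.mem_coe.2 (Finset.mem_insert_self a s)) (Finset.mem_coe.2 (Finset.mem_insert_of_mem hk))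
      (fun h => ha (h ▸ hk))

/-- **The particle number as an indicator sum**: if a unit-hard-core configuration has all its particles above the
(disjoint) cubes `k + t𝟙 + [0,1)³`, `k ∈ s`, then, by packing (`N_cube ≤ 8`), `N = ∑_{k ∈ s} ∑_{i<8} 1{i < N_k}` in `ℝ`. -/
theorem c9v_toReal_count_univ_eq_sum {ω : PointConfig Phase} (hω : IsHardCore 1 ω) (s : Finset (Fin 3 → ℕ)) (t : ℝ)
    (hcount : ω.count univ = ω.count (⋃ k ∈ s, window (c9v𝒬 k t))) :
    ((ω.count univ : ℕ∞) : ℝ≥0∞).toReal = ∑ a ∈ s ×ˢ Finset.range 8,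
      {ω' : PointConfig Phase | (a.2 : ℕ∞) < ω'.count (c9v𝒬 a.1 t ×ˢ univ)}.indicator (1 : PointConfig Phase → ℝ) ω := by
  have h4 : ∀ k : Fin 3 → ℕ, ∃ m : ℕ, ω.count (window (c9v𝒬 k t)) = m ∧ m ≤ 8 := fun k => by
    have h := c9v_count_window_cube_le hω k t
    obtain ⟨m, hm⟩ := ENat.ne_top_iff_exists.1 (ne_top_of_le_ne_top (ENat.coe_ne_top 8) h)
    refine ⟨m, hm.symm, ?_⟩
    rw [← hm] at h
    exact ENat.coe_le_coe.1 h
  choose m hm hm8 using h4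
  rw [hcount, c9v_count_biUnion_eq_sum s (c9v_pairwiseDisjoint_window_cube t _) ω, Finset.sum_congr rfl fun k _ => hm k,
    ← Nat.cast_sum, ENat.toENNReal_coe, ENNReal.toReal_natCast, Nat.cast_sum, Finset.sum_product]
  refine Finset.sum_congr rfl fun k _ => ?_
  have hind : ∀ i ∈ Finset.range 8, {ω' : PointConfig Phase | ((k, i).2 : ℕ∞) < ω'.count (c9v𝒬 (k, i).1 t ×ˢ univ)}.indicator
      (1 : PointConfig Phase → ℝ) ω = if i < m k then 1 else 0 := fun i _ => by
    by_cases hi : i < m k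
    · rw [if_pos hi, indicator_of_mem, Pi.one_apply]
      change ((i : ℕ) : ℕ∞) < ω.count (window (c9v𝒬 k t))
      rw [hm k]; exact_mod_cast hi
    · rw [if_neg hi, indicator_of_notMem]
      change ¬ ((i : ℕ) : ℕ∞) < ω.count (window (c9v𝒬 k t))
      rw [hm k]; exact_mod_cast hi
  rw [Finset.sum_congr rfl hind, c9v_sum_range_ite_lt_eq (hm8 k)]

/-! ## The cubes of the centred box -/

/-- **The centred box is tiled by its unit cubes**: `Λ_n = ⋃_{k ∈ {0,…,2n+1}³} (k - (n+1) + [0,1)³)`. -/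
theorem c9v_centredBox_eq_biUnion (n : ℕ) : centredBox (d := Fin 3) n = ⋃ k ∈ c9vℒ n, c9v𝒬 k (-((n : ℝ) + 1)) := by
  ext x
  simp only [centredBox, mem_setOf_eq, mem_iUnion, Fintype.mem_piFinset, Finset.mem_range, exists_prop]
  constructor
  · intro hx
    have hx' : ∀ l, 0 ≤ x l + ((n : ℝ) + 1) ∧ x l + ((n : ℝ) + 1) < ((2 * (n + 1) : ℕ) : ℝ) := fun l => by
      have h := hx l
      rw [mem_Ico] at h
      push_cast
      constructor <;> linarith [h.1, h.2]
    refine ⟨fun l => ⌊x l + ((n : ℝ) + 1)⌋₊, fun l => ?_, fun l => ?_⟩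
    · have h := (Nat.floor_le (hx' l).1).trans_lt (hx' l).2
      exact_mod_cast h
    · have h1 := Nat.floor_le (hx' l).1
      have h2 := Nat.lt_floor_add_one (x l + ((n : ℝ) + 1))
      rw [mem_Ico]
      constructor <;> linarith
  · rintro ⟨k, hk, hxk⟩ l
    have h := hxk l
    have hkl : (k l : ℝ) ≤ 2 * n + 1 := by
      have h' := hk l
      exact_mod_cast (by omega : k l ≤ 2 * n + 1)
    have hk0 : (0 : ℝ) ≤ k l := Nat.cast_nonneg _
    rw [mem_Ico] at h ⊢
    constructor <;> linarith [h.1, h.2]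

/-! ## The variance bound -/

/-- **(B2) The particle number of a free low-activity hard-sphere box has variance `O(volume)`.** For the free
grand-canonical unit-diameter hard-sphere measure `R_n = γ_{Λ_n}(· | ∅)` (`gibbsSpecMeasure 1 z β u (centredBox n) ∅`,
activity `0 < z ≤ 1/64`, `β > 0`) on `Λ_n = [-(n+1), n+1)³`, `Var_{R_n}(N) ≤ C (n+1)³` with `C` independent of `n`.
Proof: `N = ∑_{cubes b} ∑_{i<8} 1{i < N_b}` a.s. (tiling of `Λ_n` by `8(n+1)³` unit cubes, packing `N_b ≤ 8`, no particle
off `Λ_n`), so `Var N` is the double sum of the covariances of these indicator events; the covariance of the events of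
two cubes at lattice distance `r ≥ 4` is `≤ (3/2)(16z)^{r-4}` by the decorrelation of the free measure
(Michelen–Perkins disagreement bound, tree theorem `abs_measureReal_inter_sub_mul_le`, transported to boxes by
restricting the intensity and translating), and `≤ 1` otherwise; the resulting lattice sum over the partner cube is
bounded uniformly (`≤ (3/2)^13 · 6³`). -/
theorem c9_free_count_variance_le {z β : ℝ} {u : V3} (hz : 0 < z) (hz1 : z ≤ 1 / 64) (hβ : 0 < β) :
    ∃ C : ℝ, ∀ n : ℕ,
      ∫ ω, ((((ω.count univ : ℕ∞) : ℝ≥0∞).toReal) -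
          ∫ ω', (((ω'.count univ : ℕ∞) : ℝ≥0∞).toReal) ∂(gibbsSpecMeasure 1 z β u (centredBox n) ∅)) ^ 2
        ∂(gibbsSpecMeasure 1 z β u (centredBox n) ∅) ≤ C * ((n : ℝ) + 1) ^ 3 := by
  refine ⟨8 * (64 * ((3 / 2) ^ 13 * 6 ^ 3)), fun n => ?_⟩
  haveI := c9v_isLocallyFiniteMeasure_intensity z hβ u
  obtain ⟨h0, -, -, hfin⟩ := c9v_intensity_hypotheses hz hz1 hβ u
  have hΛm : MeasurableSet (centredBox (d := Fin 3) n) := measurableSet_centredBox_fin3 n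
  have hΛb : Bornology.IsBounded (centredBox (d := Fin 3) n) := isBounded_centredBox n
  obtain ⟨R₀, hR₀⟩ := hΛb.subset_ball 0
  set P := gibbsSpecMeasure 1 z β u (centredBox (d := Fin 3) n) ∅ with hPdef
  have hPeq : P = hsLocalSpec 1 (c9vν z β u) (centredBox (d := Fin 3) n) ∅ :=
    c9v_gibbsSpecMeasure_empty_eq_hsLocalSpec hz.le hβ u hΛm hΛb
  haveI : IsProbabilityMeasure P := hPeq ▸ isProbabilityMeasure_hsLocalSpec _ h0 hΛm
      (ne_top_of_le_ne_top (hfin R₀) (measure_mono (window_mono hR₀))) ((isHardCore_empty 1).restrict _)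
  -- a.s. the particle number is the indicator sum over the cubes of `Λ_n`
  have hNS : ∀ᵐ ω ∂P, ((ω.count univ : ℕ∞) : ℝ≥0∞).toReal = ∑ a ∈ c9vℒ n ×ˢ Finset.range 8,
      {ω' : PointConfig Phase | (a.2 : ℕ∞) < ω'.count (c9v𝒬 a.1 (-((n : ℝ) + 1)) ×ˢ univ)}.indicator 1 ω := by
    rw [hPeq]
    filter_upwards [hsLocalSpec_ae_isHardCore (c9vν z β u) 1 (centredBox (d := Fin 3) n) ∅,
      hsLocalSpec_empty_ae_restrict_eq_self (c9vν z β u) 1 hΛm] with ω hhc hcar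
    refine c9v_toReal_count_univ_eq_sum hhc (c9vℒ n) _ ?_
    have h2 : window (centredBox (d := Fin 3) n) = ⋃ k ∈ c9vℒ n, window (c9v𝒬 k (-((n : ℝ) + 1))) := by
      ext y
      rw [mem_window, c9v_centredBox_eq_biUnion n]
      simp only [mem_iUnion, mem_window, exists_prop]
    conv_lhs => rw [← hcar]
    rw [PointConfig.count_restrict, inter_univ, h2]
  -- variance = double sum of covariances ≤ lattice sum
  rw [c9v_variance_eq_sum_cov P _ (fun a _ => c9v_measurableSet_countEvent (c9v_measurableSet_cube _ _) _) hNS]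
  refine (c9v_sum_sum_le_of_le_geom (2 * (n + 1)) fun a b => (le_abs_self _).trans
    (c9_free_cube_count_cov_le hz hz1 hβ hΛm hΛb (-((n : ℝ) + 1)) a.1 b.1 a.2 b.2)).trans (le_of_eq ?_)
  push_cast
  ring

end Summit.AtomisticToContinuum.HydrodynamicLimit.Theorems.KiferCompactification

end
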